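import Summits.Langlands.Langlands.Theses.EisensteinDegreeShift

/-!
# `EisensteinDegreeShift.SectorComplement` (stmt-Langlands-18372) — negative-side position lemmas

Disprover's kernel-checked bookkeeping (cdisprove cycle 1, 2026-08-17) for the route's declared RESIDUAL
JUNCTION `SectorComplement := BorelFLReciprocity → Langlands` (route EisensteinDegreeShift, crux rank 9:
"THE REST OF THE SUMMIT along this line … conjecture-grade, implied by the summit, never staffed from this
route").  Write `X := BorelFLReciprocity` (the route TARGET: weak, a.e.-Satake reciprocity for irreducible,
a.e. unramified `ρ : Γ_K → GL_n(ℚ̄_p)`, `K` CM, `2 ≤ n < p`, `p` unramified in `K`, residually Borel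
integral model, crystalline above `p` for Fontaine's pinned datum with `n` distinct labelled weights of
spread `≤ p − 2`), `C` the item, `S := _root_.Langlands`.  Nothing here asserts the item, the target, a
crux or the summit; every conclusion is a negation or a (conditional) equivalence:

* `eisensteinDegreeShift_not_langlands_of_not_weakB`: direction (B) of the summit in weak (a.e.-Satake)
  form, stated NEGATIVELY for every `K`, `n ≥ 1`, `p` — an irreducible, a.e. unramified `ρ`, de Rham above
  `p` for the pinned datum, WITHOUT an L-algebraic cuspidal partner refutes the formal summit (`𝓡` from the
  `Nonempty` conjunct; `𝓡.pst p v hv` is `fontainePstAdicCompletion v p hv` by definition; `Corresponds.1`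
  is the a.e. Satake clause);
* `eisensteinDegreeShift_not_langlands_of_not_target`: `¬ X → ¬ S` — the Borel–Fontaine–Laffaille sector is
  INSIDE the summit as typed (of X's hypotheses only irreducibility, a.e.-unramifiedness and crystalline ⇒
  de Rham are used; CM, `2 ≤ n < p`, `p` unramified, the Borel model and the weight clause are discarded),
  so a counterexample in the sector refutes Fontaine–Mazur–Langlands and PROVES the junction ex falso — it
  never refutes the junction (`eisensteinDegreeShift_sectorComplement_and_not_langlands_iff_not_target`);
* `eisensteinDegreeShift_not_sectorComplement_iff`: `¬ C ↔ X ∧ ¬ S` — a refutation of the junction is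
  EXACTLY a proof of the open sector theorem together with a refutation of the audited summit; truth table
  `eisensteinDegreeShift_sectorComplement_iff_not_or`; `¬ C → ¬ S`;
* `eisensteinDegreeShift_langlands_iff_target_and_sectorComplement`: the exact bookkeeping identity
  `S ↔ X ∧ C` (no typing drift between the target's conclusion and direction (B));
* `eisensteinDegreeShift_sectorComplement_imp_langlands_iff_target`: `(C → S) ↔ X` — the junction
  "restates the summit" precisely iff the open target is provable; under the target, resp. under the
  route's three content cruxes, `C ↔ S` (`…_iff_langlands_of_target`, `…_iff_langlands_of_cruxes`, the
  latter through the route's sorry-free `closes`);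
* `eisensteinDegreeShift_sectorComplement_weakest`: TIGHTNESS — for every `J`, `(X ∧ J → S) ↔ (J → C)`:
  the junction is the weakest proposition closing the summit together with the target, so no cheaper
  junction exists for this route shape.

Work file with the full analysis (debts of the junction, the registered line and its six stubs):
`Cruxes/SectorComplement/Disproof.lean`, PART IV (§E1–§E6).
-/

set_option linter.dupNamespace false -- project-wide option; `Summit.Langlands.Langlands` is the mandated namespace

namespace Summit.Langlands.Langlands.Theorems

open Summit.Langlands.Langlands.Theses.EisensteinDegreeShift
open Literature.NumberTheory.GaloisRepresentations Literature.NumberTheory.Automorphic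

/-- Direction (B) of the summit, weak (a.e.-Satake) form, stated NEGATIVELY: if some irreducible
`ρ : Γ_K → GL_n(ℚ̄_p)` (`n ≥ 1`), unramified a.e. and de Rham above `p` for Fontaine's pinned datum, has no
L-algebraic cuspidal `π` with Satake–Frobenius matching a.e. (for some `ι`, `hcpt`), the formal summit is
false. [folklore] -/
theorem eisensteinDegreeShift_not_langlands_of_not_weakB (K : Type) [Field K] [NumberField K] (n : ℕ)
    (hn : 0 < n) (p : ℕ) [Fact p.Prime] (ρ : FramedGaloisRep K (PadicAlgCl p) n)
    (hirr : ρ.toGaloisRep.IsIrreducible)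
    (hunr : ∀ᶠ v : IsDedekindDomain.HeightOneSpectrum (NumberField.RingOfIntegers K) in Filter.cofinite,
      ρ.IsUnramifiedAt v)
    (hdR : ∀ (v : IsDedekindDomain.HeightOneSpectrum (NumberField.RingOfIntegers K))
      (hv : ((p : ℕ) : NumberField.RingOfIntegers K) ∈ v.asIdeal),
      (Literature.NumberTheory.PAdicHodge.fontainePstAdicCompletion v p hv).IsDeRhamFramed (ρ.toLocal v))
    (ι : PadicAlgCl p ≃+* ℂ) (hcpt : isCompact_glFiniteIntegralLevel n K)
    (hno : ¬ ∃ π : CuspidalAutomorphicRepData n K hcpt, π.1.IsLAlgebraic ∧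
      ∀ᶠ v : IsDedekindDomain.HeightOneSpectrum (NumberField.RingOfIntegers K) in Filter.cofinite,
        Summit.Langlands.SatakeFrobCompatibleAt ι π.1 ρ v) :
    ¬ _root_.Langlands := by
  intro hL
  obtain ⟨⟨𝓡⟩, hGL⟩ := hL K
  obtain ⟨π, hLalg, hcorr⟩ := (hGL 𝓡 n hn hcpt).2 p ι ρ hirr ⟨hunr, fun v hv ↦ hdR v hv⟩
  exact hno ⟨π, hLalg, hcorr.1⟩

/-- **`¬ X → ¬ S`: the Borel–Fontaine–Laffaille sector is inside the summit as typed.**  A counterexample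
to the target is a counterexample to Fontaine–Mazur–Langlands (direction (B), weak form): of the target's
hypotheses only irreducibility, a.e.-unramifiedness and crystallinity above `p` (⇒ de Rham,
`IsCrystallineFramed.isDeRhamFramed`) are used; `IsCMField K`, `2 ≤ n < p` (beyond `0 < n`), `p`
unramified, `O`, the residually-Borel integral model and the labelled-weight clause are discarded.
[folklore] -/
theorem eisensteinDegreeShift_not_langlands_of_not_target (hX : ¬ BorelFLReciprocity) :
    ¬ _root_.Langlands := by
  intro hL
  apply hX
  intro K _ _ _hK n hn p _ _hp _hur O _hO hcpt ι ρ ρ₀ hirr hae _hut hFL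
  by_contra hno
  exact eisensteinDegreeShift_not_langlands_of_not_weakB K n (by omega) p ρ hirr hae
    (fun v hv ↦ (hFL v hv).1.isDeRhamFramed) ι hcpt hno hL

/-- **Exact content of a refutation of the junction**: `¬ C ↔ X ∧ ¬ S` — prove the open sector theorem
AND refute the audited formal summit. [folklore] -/
theorem eisensteinDegreeShift_not_sectorComplement_iff :
    ¬ SectorComplement ↔ BorelFLReciprocity ∧ ¬ _root_.Langlands :=
  Classical.not_imp

/-- Truth table `C ↔ ¬ X ∨ S`. [folklore] -/
theorem eisensteinDegreeShift_sectorComplement_iff_not_or :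
    SectorComplement ↔ ¬ BorelFLReciprocity ∨ _root_.Langlands :=
  imp_iff_not_or

/-- `¬ C → ¬ S`: any refutation of the junction refutes the formal summit. [folklore] -/
theorem eisensteinDegreeShift_not_langlands_of_not_sectorComplement (h : ¬ SectorComplement) :
    ¬ _root_.Langlands :=
  (eisensteinDegreeShift_not_sectorComplement_iff.mp h).2

/-- `¬ X ↔ C ∧ ¬ S`: a failure of the target proves the junction (ex falso) and refutes the summit; and
conversely. [folklore] -/
theorem eisensteinDegreeShift_sectorComplement_and_not_langlands_iff_not_target :
    SectorComplement ∧ ¬ _root_.Langlands ↔ ¬ BorelFLReciprocity :=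
  ⟨fun h hX ↦ h.2 (h.1 hX),
    fun hX ↦ ⟨fun h ↦ (hX h).elim, eisensteinDegreeShift_not_langlands_of_not_target hX⟩⟩

/-- **Exact bookkeeping identity** `S ↔ X ∧ C`: target and junction partition the summit with no typing
drift. [folklore] -/
theorem eisensteinDegreeShift_langlands_iff_target_and_sectorComplement :
    _root_.Langlands ↔ BorelFLReciprocity ∧ SectorComplement :=
  ⟨fun hL ↦ ⟨Classical.byContradiction fun hX ↦ eisensteinDegreeShift_not_langlands_of_not_target hX hL,
      fun _ ↦ hL⟩,
    fun h ↦ h.2 h.1⟩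

/-- **Restates-summit probe, settled**: `(C → S) ↔ X` — the junction is the summit in a costume exactly
iff the open sector theorem is provable. [folklore] -/
theorem eisensteinDegreeShift_sectorComplement_imp_langlands_iff_target :
    (SectorComplement → _root_.Langlands) ↔ BorelFLReciprocity :=
  ⟨fun h ↦ Classical.byContradiction fun hX ↦
      eisensteinDegreeShift_not_langlands_of_not_target hX (h fun x ↦ (hX x).elim),
    fun hX hC ↦ hC hX⟩

/-- Under the target the junction IS the summit. [folklore] -/
theorem eisensteinDegreeShift_sectorComplement_iff_langlands_of_target (hX : BorelFLReciprocity) :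
    SectorComplement ↔ _root_.Langlands :=
  ⟨fun hC ↦ hC hX, fun h _ ↦ h⟩

/-- Under the route's three content cruxes (seed, lifting, soluble descent) the junction IS the summit
(`→` is the route's sorry-free `closes`). [folklore] -/
theorem eisensteinDegreeShift_sectorComplement_iff_langlands_of_cruxes (h₁ : EisensteinSteinbergSeed)
    (h₂ : EisensteinSeededLifting) (h₃ : SolubleDescentGLn) : SectorComplement ↔ _root_.Langlands :=
  ⟨closes h₁ h₂ h₃, fun h _ ↦ h⟩

/-- **Tightness: the junction is the WEAKEST closing proposition.**  For every `J`,
`(X ∧ J → S) ↔ (J → C)`: anything that closes the summit together with the target already implies the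
junction, so no cheaper junction exists for this route shape. [folklore] -/
theorem eisensteinDegreeShift_sectorComplement_weakest (J : Prop) :
    (BorelFLReciprocity ∧ J → _root_.Langlands) ↔ (J → SectorComplement) :=
  ⟨fun h hJ hX ↦ h ⟨hX, hJ⟩, fun h hXJ ↦ h hXJ.2 hXJ.1⟩

end Summit.Langlands.Langlands.Theorems
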